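import Summits.AnomalousDissipation.AnomalousDissipation.Theorems.MarginalStabilityChainStrainedLayerLawClockReduction
import Literature.Analysis.FluidPDE.StretchedLayerNSBurgersTails
import HarnessLib

/-!
# Crux `MarginalStabilityChain.StrainedLayerLaw` (stmt-AnomalousDissipation-3007), line `FirstLemmasR2K4`
# (log-enstrophy clock + Nash roundness): the LAMINAR MEMBER and the tightness of the roundness stub

Support file (`--supports stmt-AnomalousDissipation-3007`; registered sub-goal `roundnessFloor_theta_zero_false`).
Line lead c4 (`prover-line-stmt-AnomalousDissipation-3007-c4-0`, 2026-08-16). Contents: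

* §1 THE LAMINAR MEMBER in the line's vocabulary: at `θ = 0` the Burgers shear layer `(U_B^ν, 0, 0)`,
  `U_B^ν = burgersShearLayer 1 ν 1` (Literature `StretchedLayerNSBurgers`), is a member of `InCruxClass ν L 0 0`
  (non-vacuity of the crux's class in its own inlined normalisation, importable), a classical solution on `(0,∞)`,
  with the line's shear tails `ExpTails (Icc a b)` (from `hasShearLayerTails_burgersShearLayer` — the laminar state
  also satisfies the recommended class repair) and constant, locally finite dissipation `√ν/(2√π)`;
* §2 ITS CLOCK FUNCTIONALS IN CLOSED FORM: `M₋ = L`, `νΩ₋ = L√ν/(2√π)`, and — by the landed negative-enstrophy law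
  applied to a steady solution — `Ω₋ = 2νP₋` EXACTLY (the laminar sheet is the equality case of
  `clock_magnitude_law`; no palinstrophy integral is evaluated); hence the laminar Nash roundness
  `Ω₋²/(M₋²P₋) = √ν/(√π L)` (`laminar_roundness`);
* §3 THE CRUX PINNED AT `θ = 0` IS FALSE, importably (`strainedLayerLaw_theta_zero_false`; the disprover's §2 in the
  line's vocabulary: the laminar member has `meanLayerDissipation = ofReal (√ν/(2√π))`);
* §4 TIGHTNESS OF THE OPEN STUB: `laminar_not_round` (strict failure of the roundness inequality at every `t > 0`
  once `√ν < √π·r·min(L,1)`) and the registered sub-goal `roundnessFloor_theta_zero_false` — `stub_roundnessFloor`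
  with its `∃ θ` witnessed by `0` is FALSE for every `r`: the perturbation is load-bearing for the STUB (the
  stub-level image of the disprover's `lawAt_zero_false`, Cruxes/StrainedLayerLaw/Disproof.lean §2), and the
  quantitative gap any proof of B3 must open by an `x`-dependent `θ` is `√ν/(√π L)` versus `r⋆·min(L,1)/L`.

No facts are asserted; no definitions. References: `…ClockLine.lean` (negMass/negEnstrophy/negPalinstrophy),
`…ClockStubNegEnstrophyLaw.lean` (p126337), `…ClockStubLevelSetNull.lean` (p125255), `…SumRuleShearTails.lean`
(p120875), Literature `StretchedLayerNSBurgers(Tails).lean`.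
-/

noncomputable section

open scoped Topology ENNReal
open Filter Set Function MeasureTheory

-- `Summit.<Summit>.<Problem>` is the tree's mandated summit-side namespace (CONVENTIONS §2); for this
-- single-conjunct summit the two coincide, so the duplicate is deliberate.
set_option linter.dupNamespace false

namespace Summit.AnomalousDissipation.AnomalousDissipation.Theorems.StrainedLayerLaw.LogEnstrophyClock

open Literature.Analysis.FluidPDE Literature.Analysis.FluidPDE.StretchedLayer
open Summit.AnomalousDissipation.AnomalousDissipation.Theses.MarginalStabilityChain
open Summit.AnomalousDissipation.AnomalousDissipation.Theorems.StrainedLayerLaw.StrainWorkSumRule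

/-! ## §1 The laminar member of the crux's class (`θ = 0`) -/

/-- **The Burgers shear layer is a member of the crux's class at `θ = 0`.** For `ν > 0` and every period `L`,
`(U_B^ν, 0, 0)` with `U_B^ν = burgersShearLayer 1 ν 1` satisfies `InCruxClass ν L 0 0`: `C²` for `t > 0`,
continuous up to `t = 0`, the stretched system (`νU_B'' = −yU_B'`), periodic, far field `±½`, and the crux's
inlined datum `(2πν)^{-1/2}∫₀^y e^{−s²/2ν} ds = U_B^ν(y)` (`burgersLayerProfile_one_eq`). Non-vacuity of the
class in the crux's own normalisation (cf. the disprover's `lawAt_zero_false`, here importable). [folklore] -/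
theorem inCruxClass_burgersShearLayer {ν : ℝ} (hν : 0 < ν) (L : ℝ) :
    InCruxClass ν L (fun _ _ => 0) (fun _ _ => 0) (burgersShearLayer 1 ν 1) (fun _ _ _ => 0)
      (fun _ _ _ => 0) := by
  have hU3 := contDiff_burgersShearLayer 1 ν 1
  refine ⟨hU3.contDiffOn, contDiffOn_const, contDiffOn_const, hU3.continuous.continuousOn,
    continuousOn_const, ?_, fun _ _ _ _ => ⟨rfl, rfl, rfl⟩, ?_, ?_⟩
  · intro t x y _
    refine ⟨?_, ?_, ?_⟩
    · have hode := burgersLayerProfile_ode 1 ν 1 y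
      simp only [burgersShearLayer_apply, deriv_const, deriv_burgersLayerProfile_eq_D,
        deriv_burgersLayerProfileD_eq_DD, mul_zero, zero_add, add_zero, neg_zero, zero_sub]
      linarith
    · simp
    · simp
  · intro t x _
    exact ⟨tendsto_burgersLayerProfile_atTop one_pos hν 1, tendsto_burgersLayerProfile_atBot one_pos hν 1,
      tendsto_const_nhds, tendsto_const_nhds⟩
  · intro x y
    refine ⟨?_, rfl⟩
    simp only [burgersShearLayer_apply, add_zero]
    rw [burgersLayerProfile_one_eq hν 1 y, one_mul]

/-- The laminar member is a classical solution of the Literature structure on `(0, ∞)`. [folklore] -/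
theorem isSolution_burgersShearLayer {ν : ℝ} (hν : 0 < ν) (L : ℝ) :
    IsStretchedLayerNSSolutionOn (Ioi 0) ν 1 1 L (burgersShearLayer 1 ν 1) (fun _ _ _ => 0) (fun _ _ _ => 0) :=
  isStretchedLayerNSSolutionOn_burgersShearLayer one_pos hν 1 L 0 (Ioi 0)

/-- The laminar member has the line's uniform exponential shear tails on every compact `[a, b] ⊂ (0, ∞)`
(from `hasShearLayerTails_burgersShearLayer`). [folklore] -/
theorem expTails_burgersShearLayer {ν : ℝ} (hν : 0 < ν) :
    ∀ a b : ℝ, 0 < a → a < b → ExpTails (Icc a b) (burgersShearLayer 1 ν 1) (fun _ _ _ => 0) :=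
  fun _ _ ha hab => expTails_of_hasShearLayerTails (hasShearLayerTails_burgersShearLayer one_pos hν) ha hab.le

/-- The laminar member's dissipation per unit area is the constant `√ν/(2√π)` (the Sweet–Parker rung). [folklore] -/
theorem layerDissipation_laminar {ν L : ℝ} (hν : 0 < ν) (hL : 0 < L) (t : ℝ) :
    layerDissipation ν L (burgersShearLayer 1 ν 1 t) (fun _ _ => 0) =
      ENNReal.ofReal (Real.sqrt ν / (2 * Real.sqrt Real.pi)) := by
  rw [layerDissipation_burgersShearLayer one_pos hν hL 1 t]
  simp

/-- The laminar member has locally finite dissipation: `∫⁻_{(0,T]} D = T·√ν/(2√π) < ⊤`. [folklore] -/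
theorem lintegral_layerDissipation_laminar_ne_top {ν L : ℝ} (hν : 0 < ν) (hL : 0 < L) :
    ∀ T : ℝ, 0 < T →
      ∫⁻ t in Ioc 0 T, layerDissipation ν L (burgersShearLayer 1 ν 1 t) ((fun _ _ _ => (0:ℝ)) t) ≠ ∞ := by
  intro T _
  simp_rw [layerDissipation_laminar hν hL]
  rw [setLIntegral_const]
  exact ENNReal.mul_ne_top ENNReal.ofReal_ne_top (by simp [Real.volume_Ioc])

/-! ## §2 The clock functionals of the laminar slice in closed form -/

/-- The laminar vorticity is `−U_B'(y)` (negative everywhere). [folklore] -/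
theorem vorticity_laminar (ν t x y : ℝ) :
    vorticity (burgersShearLayer 1 ν 1 t) (fun _ _ => 0) x y = -burgersLayerProfileD 1 ν 1 y := by
  simp [StrainWorkSumRule.vorticity, dX, dY, deriv_burgersLayerProfile_eq_D]

/-- **`M₋ = L`** for the laminar slice: `∫_{(0,L]}∫_ℝ U_B' = L · 1`. [folklore] -/
theorem negMass_laminar {ν L : ℝ} (hν : 0 < ν) (hL : 0 < L) (t : ℝ) :
    negMass L (burgersShearLayer 1 ν 1 t) (fun _ _ => 0) = L := by
  unfold negMass
  simp_rw [vorticity_laminar, neg_neg]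
  have hmax : ∀ y, max (burgersLayerProfileD 1 ν 1 y) 0 = burgersLayerProfileD 1 ν 1 y := fun y =>
    max_eq_left (burgersLayerProfileD_nonneg 1 ν zero_le_one y)
  simp_rw [hmax, integral_burgersLayerProfileD one_pos hν 1]
  rw [setIntegral_const, measureReal_def, Real.volume_Ioc, sub_zero, ENNReal.toReal_ofReal hL.le, smul_eq_mul,
    mul_one]

/-- **`Ω₋ = L ∫ (U_B')²`** for the laminar slice, hence `ν Ω₋ = L √ν/(2√π)`. [folklore] -/
theorem nu_mul_negEnstrophy_laminar {ν L : ℝ} (hν : 0 < ν) (hL : 0 < L) (t : ℝ) :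
    ν * negEnstrophy L (burgersShearLayer 1 ν 1 t) (fun _ _ => 0) = L * (Real.sqrt ν / (2 * Real.sqrt Real.pi)) := by
  unfold negEnstrophy
  simp_rw [vorticity_laminar, neg_neg]
  have hmax : ∀ y, max (burgersLayerProfileD 1 ν 1 y) 0 = burgersLayerProfileD 1 ν 1 y := fun y =>
    max_eq_left (burgersLayerProfileD_nonneg 1 ν zero_le_one y)
  simp_rw [hmax]
  rw [setIntegral_const, measureReal_def, Real.volume_Ioc, sub_zero, ENNReal.toReal_ofReal hL.le, smul_eq_mul]
  have h := nu_mul_integral_burgersLayerProfileD_sq one_pos hν 1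
  simp only [one_pow, one_mul] at h
  calc ν * (L * ∫ s, burgersLayerProfileD 1 ν 1 s ^ 2) = L * (ν * ∫ s, burgersLayerProfileD 1 ν 1 s ^ 2) := by ring
    _ = L * (Real.sqrt ν / (2 * Real.sqrt Real.pi)) := by rw [h]

/-- **The clock is EXACT on the laminar member: `Ω₋ = 2νP₋`** (`t > 0`). The landed negative-enstrophy law
`Ω₋′ = Ω₋ − 2νP₋` (`stub_negEnstrophyLaw` fed with `stub_levelSetNull`) applies to the tailed laminar solution, whose
`Ω₋` is constant in time; so the clock rate `1 − 2νP₋/Ω₋` vanishes identically — the laminar sheet sits exactly at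
the equality case of `clock_magnitude_law`. (No palinstrophy integral is evaluated.) [folklore] -/
theorem negEnstrophy_eq_two_nu_negPalinstrophy_laminar {ν L : ℝ} (hν : 0 < ν) (hL : 0 < L) {t : ℝ} (ht : 0 < t) :
    negEnstrophy L (burgersShearLayer 1 ν 1 t) (fun _ _ => 0) =
      2 * ν * negPalinstrophy L (burgersShearLayer 1 ν 1 t) (fun _ _ => 0) := by
  have hlaw := stub_negEnstrophyLaw stub_levelSetNull ν L hν hL (burgersShearLayer 1 ν 1) (fun _ _ _ => 0)
    (fun _ _ _ => 0) (isSolution_burgersShearLayer hν L) (expTails_burgersShearLayer hν) t ht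
  -- the function `s ↦ Ω₋(s)` is constant (the member is steady: `burgersShearLayer 1 ν 1 s` is the same slice for
  -- every `s`, definitionally), so its derivative is `0`
  have hlaw' : HasDerivAt (fun _ : ℝ => negEnstrophy L (fun (_ : ℝ) (y : ℝ) => burgersLayerProfile 1 ν 1 y)
      (fun _ _ => (0:ℝ)))
      (negEnstrophy L (burgersShearLayer 1 ν 1 t) (fun _ _ => 0) -
        2 * ν * negPalinstrophy L (burgersShearLayer 1 ν 1 t) (fun _ _ => 0)) t := hlaw
  have h0 := hlaw'.unique (hasDerivAt_const t _)
  linarith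

/-- **Laminar roundness in closed form**: `Ω₋² = ((ν/π)^{1/2}/L) · M₋² P₋` for `t > 0` — the Nash roundness of
the laminar sheet is `r_lam = √ν/(√π L) → 0` as `ν → 0`. [folklore] -/
theorem laminar_roundness {ν L : ℝ} (hν : 0 < ν) (hL : 0 < L) {t : ℝ} (ht : 0 < t) :
    negEnstrophy L (burgersShearLayer 1 ν 1 t) (fun _ _ => 0) ^ 2 =
      Real.sqrt ν / (Real.sqrt Real.pi * L) *
        (negMass L (burgersShearLayer 1 ν 1 t) (fun _ _ => 0) ^ 2 *
          negPalinstrophy L (burgersShearLayer 1 ν 1 t) (fun _ _ => 0)) := by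
  set Ω := negEnstrophy L (burgersShearLayer 1 ν 1 t) (fun _ _ => 0) with hΩ
  set P := negPalinstrophy L (burgersShearLayer 1 ν 1 t) (fun _ _ => 0) with hP
  have hM : negMass L (burgersShearLayer 1 ν 1 t) (fun _ _ => 0) = L := negMass_laminar hν hL t
  have hνΩ : ν * Ω = L * (Real.sqrt ν / (2 * Real.sqrt Real.pi)) := nu_mul_negEnstrophy_laminar hν hL t
  have hΩP : Ω = 2 * ν * P := negEnstrophy_eq_two_nu_negPalinstrophy_laminar hν hL ht
  have hsν : Real.sqrt ν ^ 2 = ν := Real.sq_sqrt hν.le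
  have hsνpos : 0 < Real.sqrt ν := Real.sqrt_pos.2 hν
  have hsπ : 0 < Real.sqrt Real.pi := Real.sqrt_pos.2 Real.pi_pos
  rw [hM]
  -- `P = Ω/(2ν)` and `Ω = L√ν/(2√π ν)`; both sides equal `Ω²`
  have hP' : P = Ω / (2 * ν) := by rw [hΩP]; field_simp
  have hΩ' : Ω = L * Real.sqrt ν / (2 * Real.sqrt Real.pi * ν) := by
    field_simp at hνΩ ⊢; linarith
  rw [hP', hΩ', ← hsν]
  field_simp

/-! ## §3 The crux's law pinned at `θ = 0` fails (importable form of the disprover's §2) -/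

/-- The Cesàro `liminf` of a constant-in-time dissipation is that constant (`T⁻¹·(K·T) = K` for `T > 0`).
(Private copy of `Disproof.liminf_timeMean_const`, a crux workfile that is not importable.) [folklore] -/
private theorem liminf_timeMean_const' (K : ℝ≥0∞) :
    Filter.liminf (fun T : ℝ => ENNReal.ofReal T⁻¹ * ∫⁻ _ in Set.Ioc 0 T, K) Filter.atTop = K := by
  have h : ∀ᶠ T : ℝ in atTop, ENNReal.ofReal T⁻¹ * ∫⁻ _ in Set.Ioc 0 T, K = K := by
    filter_upwards [eventually_gt_atTop 0] with T hT
    rw [setLIntegral_const, Real.volume_Ioc, sub_zero, mul_comm K, ← mul_assoc,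
      ← ENNReal.ofReal_mul (inv_nonneg.2 hT.le), inv_mul_cancel₀ hT.ne', ENNReal.ofReal_one, one_mul]
  rw [Filter.liminf_congr h, Filter.liminf_const]

/-- **Mean dissipation of the laminar member**: `meanLayerDissipation ν L U_B^ν 0 = ofReal (√ν/(2√π))` — the
Sweet–Parker rung, `→ 0` as `ν → 0`. [folklore] -/
theorem meanLayerDissipation_laminar {ν L : ℝ} (hν : 0 < ν) (hL : 0 < L) :
    meanLayerDissipation ν L (burgersShearLayer 1 ν 1) (fun _ _ _ => 0) =
      ENNReal.ofReal (Real.sqrt ν / (2 * Real.sqrt Real.pi)) := by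
  rw [meanLayerDissipation_def]
  simp_rw [layerDissipation_laminar hν hL]
  exact liminf_timeMean_const' _

/-- **The crux with its `∃ θ` witnessed by `0` is FALSE** (importable form of `Disproof.lawAt_zero_false` /
`not_strainedLayerLaw_theta_zero`, in the line's vocabulary `InCruxClass`/`meanLayerDissipation`): the laminar member
has mean dissipation `√ν/(2√π) < c·min(L,1)` once `ν < 4πc²min(L,1)²`. So any proof of the crux uses its
perturbation non-trivially. [folklore] -/
theorem strainedLayerLaw_theta_zero_false :
    ¬ ∃ c : ℝ, 0 < c ∧ ∀ L : ℝ, 0 < L → ∃ ν₀ : ℝ, 0 < ν₀ ∧ ∀ ν : ℝ, 0 < ν → ν ≤ ν₀ →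
        ∀ (u v p : ℝ → ℝ → ℝ → ℝ), InCruxClass ν L (fun _ _ => 0) (fun _ _ => 0) u v p →
          ENNReal.ofReal (c * min L 1) ≤ meanLayerDissipation ν L u v := by
  rintro ⟨c, hc, h⟩
  obtain ⟨ν₀, hν₀, hall⟩ := h 1 one_pos
  set ν : ℝ := min ν₀ (Real.pi * c ^ 2) with hνdef
  have hν : 0 < ν := lt_min hν₀ (by positivity)
  have hνle : ν ≤ ν₀ := min_le_left _ _
  have key := hall ν hν hνle (burgersShearLayer 1 ν 1) (fun _ _ _ => 0) (fun _ _ _ => 0)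
    (inCruxClass_burgersShearLayer hν 1)
  rw [meanLayerDissipation_laminar hν one_pos, min_self, mul_one,
    ENNReal.ofReal_le_ofReal_iff (by positivity)] at key
  -- `√ν ≤ √π c`, so `√ν/(2√π) ≤ c/2 < c`
  have hsπ : 0 < Real.sqrt Real.pi := Real.sqrt_pos.2 Real.pi_pos
  have h1 : Real.sqrt ν ≤ Real.sqrt (Real.pi * c ^ 2) := Real.sqrt_le_sqrt (min_le_right _ _)
  have h2 : Real.sqrt (Real.pi * c ^ 2) = Real.sqrt Real.pi * c := by
    rw [Real.sqrt_mul Real.pi_pos.le, Real.sqrt_sq hc.le]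
  have h3 : Real.sqrt ν / (2 * Real.sqrt Real.pi) ≤ c / 2 := by
    rw [div_le_iff₀ (by positivity)]; nlinarith
  linarith

/-! ## §4 Tightness of the roundness stub: `θ` is load-bearing for `stub_roundnessFloor` -/

/-- **The laminar member is NOT round once `√ν < √π · r · min(L,1)`**: at every `t > 0` the roundness
inequality of `stub_roundnessFloor` FAILS strictly along `(U_B^ν, 0, 0)`:
`Ω₋² < (r·min(L,1)/L)·M₋²·P₋`. (`M₋ = L`, `νΩ₋ = L√ν/(2√π)`, `2νP₋ = Ω₋`: the inequality reduces to
`√ν/√π < r·min(L,1)`.) [folklore] -/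
theorem laminar_not_round {r L ν : ℝ} (hr : 0 < r) (hL : 0 < L) (hν : 0 < ν)
    (hsmall : Real.sqrt ν < Real.sqrt Real.pi * (r * min L 1)) {t : ℝ} (ht : 0 < t) :
    negEnstrophy L (burgersShearLayer 1 ν 1 t) (fun _ _ => 0) ^ 2 <
      r * min L 1 / L * negMass L (burgersShearLayer 1 ν 1 t) (fun _ _ => 0) ^ 2 *
        negPalinstrophy L (burgersShearLayer 1 ν 1 t) (fun _ _ => 0) := by
  set Ω := negEnstrophy L (burgersShearLayer 1 ν 1 t) (fun _ _ => 0) with hΩ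
  set P := negPalinstrophy L (burgersShearLayer 1 ν 1 t) (fun _ _ => 0) with hP
  have hM : negMass L (burgersShearLayer 1 ν 1 t) (fun _ _ => 0) = L := negMass_laminar hν hL t
  have hνΩ : ν * Ω = L * (Real.sqrt ν / (2 * Real.sqrt Real.pi)) := nu_mul_negEnstrophy_laminar hν hL t
  have hΩP : Ω = 2 * ν * P := negEnstrophy_eq_two_nu_negPalinstrophy_laminar hν hL ht
  have hsν : Real.sqrt ν ^ 2 = ν := Real.sq_sqrt hν.le
  have hsνpos : 0 < Real.sqrt ν := Real.sqrt_pos.2 hν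
  have hsπ : 0 < Real.sqrt Real.pi := Real.sqrt_pos.2 Real.pi_pos
  have hm : 0 < min L 1 := lt_min hL one_pos
  have hΩpos : 0 < Ω := by
    have : 0 < ν * Ω := by rw [hνΩ]; positivity
    exact pos_of_mul_pos_right this hν.le
  have hPpos : 0 < P := by nlinarith
  rw [hM]
  -- reduce to `Ω < r·min(L,1)·L/(2ν)`, i.e. `2νΩ = L√ν/√π < r·min(L,1)·L`
  have hP' : P = Ω / (2 * ν) := by rw [hΩP]; field_simp
  rw [hP']
  have key : Ω < r * min L 1 * L / (2 * ν) := by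
    rw [lt_div_iff₀ (by positivity)]
    -- `Ω·2ν = L√ν/√π` and `√ν/√π < r min(L,1)`
    have h1 : Ω * (2 * ν) = L * (Real.sqrt ν / Real.sqrt Real.pi) := by
      have : Ω * (2 * ν) = 2 * (ν * Ω) := by ring
      rw [this, hνΩ]; field_simp
    have h2 : Real.sqrt ν / Real.sqrt Real.pi < r * min L 1 := by
      rw [div_lt_iff₀ hsπ]; linarith
    rw [h1]
    nlinarith
  have hΩ2 : Ω ^ 2 = Ω * Ω := sq Ω
  rw [hΩ2]
  have : r * min L 1 / L * L ^ 2 * (Ω / (2 * ν)) = Ω * (r * min L 1 * L / (2 * ν)) := by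
    field_simp
  rw [this]
  exact mul_lt_mul_of_pos_left key hΩpos

/-- **`stub_roundnessFloor` with `θ` pinned to `0` is FALSE (registered sub-goal; Negative-style tightness lemma).**
For every `r > 0`, `L > 0`, `ν₀ > 0` there is an admissible viscosity `ν ≤ ν₀` (any `ν` with
`√ν < √π·r·min(L,1)`) at which the laminar member `(U_B^ν, 0, 0)` — in the class from the UNPERTURBED datum, with
locally finite dissipation and shear tails — violates the roundness conclusion at EVERY `t > 0`. Hence any proof of
the line's open stub B3 must use its perturbation `θ` non-trivially (indeed an `x`-dependent one, by the disprover's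
§4): the stub-level image of `Disproof.lawAt_zero_false`, and the quantitative gap a proof must open — the laminar
sheet has roundness `√ν/(√π L)` against the demanded `r⋆·min(L,1)/L`. [folklore] -/
theorem roundnessFloor_theta_zero_false :
    ¬ ∃ r : ℝ, 0 < r ∧ ∀ L : ℝ, 0 < L → ∃ ν₀ : ℝ, 0 < ν₀ ∧
        ∀ ν : ℝ, 0 < ν → ν ≤ ν₀ → ∀ (u v p : ℝ → ℝ → ℝ → ℝ),
          InCruxClass ν L (fun _ _ => 0) (fun _ _ => 0) u v p →
          (∀ T : ℝ, 0 < T → ∫⁻ t in Ioc 0 T, layerDissipation ν L (u t) (v t) ≠ ∞) →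
          (∀ a b : ℝ, 0 < a → a < b → ExpTails (Icc a b) u v) →
            ∃ T₁ : ℝ, 0 < T₁ ∧ ∀ t : ℝ, T₁ ≤ t →
              r * min L 1 / L * negMass L (u t) (v t) ^ 2 * negPalinstrophy L (u t) (v t) ≤
                negEnstrophy L (u t) (v t) ^ 2 := by
  rintro ⟨r, hr, h⟩
  obtain ⟨ν₀, hν₀, hall⟩ := h 1 one_pos
  -- an admissible viscosity with `√ν < √π r`
  set m : ℝ := Real.sqrt Real.pi * (r * min 1 1) with hm
  have hmpos : 0 < m := by rw [hm]; positivity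
  set ν : ℝ := min ν₀ (m ^ 2 / 4) with hνdef
  have hν : 0 < ν := lt_min hν₀ (by positivity)
  have hνle : ν ≤ ν₀ := min_le_left _ _
  have hsmall : Real.sqrt ν < m := by
    have h1 : Real.sqrt ν ≤ Real.sqrt (m ^ 2 / 4) := Real.sqrt_le_sqrt (min_le_right _ _)
    have h2 : Real.sqrt (m ^ 2 / 4) = m / 2 := by
      rw [show m ^ 2 / 4 = (m / 2) ^ 2 by ring, Real.sqrt_sq (by positivity)]
    linarith
  obtain ⟨T₁, hT₁, hround⟩ := hall ν hν hνle (burgersShearLayer 1 ν 1) (fun _ _ _ => 0) (fun _ _ _ => 0)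
    (inCruxClass_burgersShearLayer hν 1) (lintegral_layerDissipation_laminar_ne_top hν one_pos)
    (expTails_burgersShearLayer hν)
  have hlt := laminar_not_round hr one_pos hν hsmall hT₁
  have hle := hround T₁ le_rfl
  exact absurd hle (not_le.2 hlt)

end Summit.AnomalousDissipation.AnomalousDissipation.Theorems.StrainedLayerLaw.LogEnstrophyClock

end
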